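/-
Copyright (c) 2026 the pub-hodgecm-mathlib formalisation cell (harness21).  Prover seat hodgecm-mathlib-LH1-p01 (g11): LH4 price-list item (P2a) «M5 at the RAMIFIED CM
place — norm-one torus Cayley dress in `σ_w`-currency» (dealer LH4-plan (g6) WORD #49), 2026-09-02.  Over ★ p851647 ∕ p851653 (LH4-p02 (g8)) and ★ `RamifiedPlaceDifferent`.
-/
import Literature.NumberTheory.LocalFields.NormOneTorusCayleyChart   -- ★ p851653 `bijOn_cayley_skew_normOne`, brings ★ p851647 `bijOn_cayley_skew_level_exp` ∕ `bijOn_invCayley_normOne_level_exp`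
import Literature.NumberTheory.Automorphic.RamifiedPlaceDifferent     -- ★ `valued_two_eq_sq_of_ramified` (`|2|_w = |2|_v²`), §5 THE SKEW LINE `galAdicCompletionMap_eq_neg_iff`; brings the CM ramified-place currency
import HarnessLib

/-!
# The Cayley chart of the norm-one torus `T(L_w) = {y : σ_w y · y = 1}` at a RAMIFIED CM place, with the honest level shift `ord_w 2 = 2·ord_v 2`
# (Weil 1964 §29; Serre, *Local Fields* V §3; O'Meara §63)

Topic `NumberTheory/Automorphic`; namespace `Literature.NumberTheory.Automorphic.UnitaryGroup` (= ★ `RamifiedPlaceDifferent`'s).  THEOREMS ONLY (no definition,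
no instance, no notation, no named fact, no `sorry`); kernel lane `--supports stmt-HodgeConjecture-24833`, count-neutral.  Cell `pub/hodgecm-mathlib` (D-0151), crux
H413 = `stmt-HodgeConjecture-24833`, half A line LH4 (M4∕M5 wall), price-list item (P2a) of LH4-plan (g6) WORD #40∕#49: the SCALAR Cayley level shift of mechanism M5
(★ `CayleyLevelShift`, ★ p851647 `NormOneTorusCayleyLevelShift`, ★ p851653 `NormOneTorusCayleyChart` — generic valued field `K`, involution `σ`, `|2| = exp(−e)`) READ
AT A RAMIFIED CM PLACE in the currency every ramified type-(2) row and every ★ `RamifiedPlace*` base-layer file speaks: `L` CM, `v` a place of `L⁺`, `w ∣ v` with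
`c • w = w` (`c` = complex conjugation) and `e(w|v) ≠ 1`, `σ_w := galAdicCompletionMap c hw`, `ι_w := toPlace v w : L⁺_v →+* L_w`.
NO CURRENT CONSUMER (census (r3) of the seat, LH4 bus 2026-09-02): the ramified rows' `|2| = 1` binders feed MÖBIUS shifts of `γ` (★ `TypeTwoCayleyShiftBindersCM`,
★ `CayleyShiftOrderDeepCM`, ★ `FinExplicitTransferFactorCayleyShiftRamified`) and disc∕trace residue arithmetic, and the ramified norm-one torus is dressed by Hilbert 90
(★ `RamifiedPlaceNormOneTorus`); this file is the BASE LAYER for a (D-RAM) re-base — the Cayley chart of `T(L_w)` with the level shift said honestly.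
HONEST LABEL: HC_CM is proved only modulo the 7 printed citations (2 remaining named inputs: hLiu418 = stmt-HodgeConjecture-24832, h413 = stmt-HodgeConjecture-24833) until
rung 0 closes; count-neutral (pays no organ, opens no road).

THE MATHEMATICS.  `c(x) = (1 + x)∕(1 − x)`, inverse `y ↦ (y − 1)∕(y + 1)`.
* (C1) At EVERY non-split place (`char L_w = 0`, so `2 ≠ 0`): `c` is a bijection from the SKEW LINE `{σ_w x = −x}` onto the torus minus `−1`, `{σ_w y·y = 1, y ≠ −1}`
  (★ p851653 `bijOn_cayley_skew_normOne` at `σ := σ_w`).  The skew line itself is `ι_w(L⁺_v)·(τ − σ_w τ)` for any uniformiser `τ` — ★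
  `RamifiedPlaceDifferent.galAdicCompletionMap_eq_neg_iff` (cited, not restated).
* (C3) At a RAMIFIED place `|2|_w = |2|_v²` (★ `valued_two_eq_sq_of_ramified`), so with `|2|_v = exp(−e)` (`e = ord_v 2`; `e = 0` at a non-dyadic `v`) the scalar shift
  ★ p851647 `bijOn_cayley_skew_level_exp` reads: for `j ≥ 1`, `c : {σ_w x = −x, |x|_w ≤ exp(−j)} ≃ {σ_w y·y = 1, |y − 1|_w ≤ exp(−(j + 2e))}` — «skew level `j` ↔ torus
  level `j + 2·ord_v 2`»; and the inverse chart.  At a non-dyadic `v` (`e = 0`) levels are preserved.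

## References
* [Weil1964] A. Weil, *Sur certains groupes d'opérateurs unitaires*, Acta Math. 111 (1964), §29 (Cayley transform of norm-one ∕ unitary elements).
* [Serre1979] J.-P. Serre, *Local Fields*, GTM 67 (1979), Ch. V §3 (filtration of the units and of the norm-one group), Ch. IV §2.
* [Omeara1963] O. T. O'Meara, *Introduction to Quadratic Forms* (1963), §63 (dyadic local units, `|2| < 1`).
* [NeukirchANT1999] J. Neukirch, *Algebraic Number Theory* (1999), Ch. II (6.8)–(6.9) (`e(w|v) = 2` ⇒ `|ι y|_w = |y|_v²`).
-/

set_option autoImplicit false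

noncomputable section

open NumberField IsDedekindDomain
open scoped WithZero

namespace Literature.NumberTheory.Automorphic.UnitaryGroup

variable (L : Type) [Field L] [NumberField L] [IsCMField L] (v : HeightOneSpectrum (𝓞 ↥(maximalRealSubfield L)))
  (w : PlacesOver L v) (hw : IsCMField.complexConj L • w.1 = w.1) (he : v.asIdeal.ramificationIdx' w.1.asIdeal ≠ 1)

omit [IsCMField L] in
/-- `2 ≠ 0` in `L_w` (characteristic zero; private twin of ★ `RamifiedPlaceDifferent`'s, which is private there). [folklore] -/
private theorem two_ne_zero_adicCompletion' : (2 : w.1.adicCompletion L) ≠ 0 := by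
  rw [show (2 : w.1.adicCompletion L) = algebraMap L _ 2 by rw [map_ofNat]]
  exact (_root_.map_ne_zero (algebraMap L (w.1.adicCompletion L))).2 two_ne_zero

/-! ## §1 (C1) The Cayley chart of `T(L_w) ∖ {−1}` at any non-split place -/

/-- **(C1) THE CAYLEY CHART OF THE NORM-ONE TORUS AT `w`**: `x ↦ (1 + x)∕(1 − x)` is a bijection from the skew line `{σ_w x = −x}` onto
`{σ_w y · y = 1, y + 1 ≠ 0}`, inverse `y ↦ (y − 1)∕(y + 1)` (★ p851653 at `σ := σ_w`, `2 ≠ 0` by characteristic zero; no ramification hypothesis).  The skew line is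
`ι_w(L⁺_v)·(τ − σ_w τ)` by ★ `galAdicCompletionMap_eq_neg_iff`. [cite: Weil1964, §29] [cite: Serre1979, Ch. V §3] -/
theorem bijOn_cayley_skew_normOne_galAdicCompletionMap :
    Set.BijOn (fun x : w.1.adicCompletion L => (1 + x) / (1 - x))
      {x | galAdicCompletionMap (L := L) (IsCMField.complexConj L) hw x = -x}
      {y | galAdicCompletionMap (L := L) (IsCMField.complexConj L) hw y * y = 1 ∧ y + 1 ≠ 0} :=
  LocalFields.bijOn_cayley_skew_normOne (two_ne_zero_adicCompletion' L v w)

/-- (C1) inverse chart: `y ↦ (y − 1)∕(y + 1)` from `{σ_w y · y = 1, y + 1 ≠ 0}` onto the skew line. [cite: Weil1964, §29] -/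
theorem bijOn_invCayley_normOne_skew_galAdicCompletionMap :
    Set.BijOn (fun y : w.1.adicCompletion L => (y - 1) / (y + 1))
      {y | galAdicCompletionMap (L := L) (IsCMField.complexConj L) hw y * y = 1 ∧ y + 1 ≠ 0}
      {x | galAdicCompletionMap (L := L) (IsCMField.complexConj L) hw x = -x} :=
  LocalFields.bijOn_invCayley_normOne_skew (two_ne_zero_adicCompletion' L v w)

/-- (C1) image form: `c '' {σ_w x = −x} = {σ_w y · y = 1, y + 1 ≠ 0}`. [cite: Weil1964, §29] -/
theorem image_cayley_skew_galAdicCompletionMap :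
    (fun x : w.1.adicCompletion L => (1 + x) / (1 - x)) '' {x | galAdicCompletionMap (L := L) (IsCMField.complexConj L) hw x = -x} =
      {y | galAdicCompletionMap (L := L) (IsCMField.complexConj L) hw y * y = 1 ∧ y + 1 ≠ 0} :=
  LocalFields.image_cayley_skew (two_ne_zero_adicCompletion' L v w)

/-! ## §2 (C3) The ramified level statement: skew level `j` ↔ torus level `j + 2·ord_v 2` -/

include hw he in
/-- **`|2|_w = exp(−2e)` at a ramified place when `|2|_v = exp(−e)`** (`e = ord_v 2`; ★ `valued_two_eq_sq_of_ramified`). [cite: NeukirchANT1999, Ch. II (6.8)–(6.9)] -/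
theorem valued_two_eq_exp_of_ramified {e : ℕ} (he2 : Valued.v (2 : v.adicCompletion ↥(maximalRealSubfield L)) = WithZero.exp (-(e : ℤ))) :
    Valued.v (2 : w.1.adicCompletion L) = WithZero.exp (-((2 * e : ℕ) : ℤ)) := by
  rw [valued_two_eq_sq_of_ramified L v w hw he, he2, ← WithZero.exp_nsmul]
  congr 1
  push_cast
  ring

include he in
/-- **(C3) THE RAMIFIED LEVEL SHIFT OF THE NORM-ONE TORUS**: at a ramified CM place with `|2|_v = exp(−e)` (`e = ord_v 2`), for every `j ≥ 1` the Cayley map is a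
bijection from the skew ball of level `j`, `{σ_w x = −x, |x|_w ≤ exp(−j)}`, onto the torus level `j + 2e`, `{σ_w y · y = 1, |y − 1|_w ≤ exp(−(j + 2e))}` — «skew level `j`
↔ torus level `j + ord_w 2`, `ord_w 2 = 2·ord_v 2`» (★ p851647 `bijOn_cayley_skew_level_exp` at `|2|_w = exp(−2e)`).  At a non-dyadic `v` (`e = 0`) levels are preserved.
[cite: Serre1979, Ch. V §3] [cite: Omeara1963, §63] -/
theorem bijOn_cayley_skew_level_ramified {e : ℕ} (he2 : Valued.v (2 : v.adicCompletion ↥(maximalRealSubfield L)) = WithZero.exp (-(e : ℤ)))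
    {j : ℕ} (hj : 1 ≤ j) :
    Set.BijOn (fun x : w.1.adicCompletion L => (1 + x) / (1 - x))
      {x | galAdicCompletionMap (L := L) (IsCMField.complexConj L) hw x = -x ∧ Valued.v x ≤ WithZero.exp (-(j : ℤ))}
      {y | galAdicCompletionMap (L := L) (IsCMField.complexConj L) hw y * y = 1 ∧ Valued.v (y - 1) ≤ WithZero.exp (-((j : ℤ) + 2 * e))} := by
  have h := LocalFields.bijOn_cayley_skew_level_exp (σ := galAdicCompletionMap (L := L) (IsCMField.complexConj L) hw)
    (valued_two_eq_exp_of_ramified L v w hw he he2) hj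
  have hcast : ((j : ℤ) + ((2 * e : ℕ) : ℤ)) = (j : ℤ) + 2 * e := by push_cast; ring
  rwa [hcast] at h

include he in
/-- (C3) inverse chart: `y ↦ (y − 1)∕(y + 1)` from the torus level `j + 2e` onto the skew ball of level `j` (`|2|_v = exp(−e)`, `j ≥ 1`).
[cite: Serre1979, Ch. V §3] [cite: Omeara1963, §63] -/
theorem bijOn_invCayley_normOne_level_ramified {e : ℕ} (he2 : Valued.v (2 : v.adicCompletion ↥(maximalRealSubfield L)) = WithZero.exp (-(e : ℤ)))
    {j : ℕ} (hj : 1 ≤ j) :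
    Set.BijOn (fun y : w.1.adicCompletion L => (y - 1) / (y + 1))
      {y | galAdicCompletionMap (L := L) (IsCMField.complexConj L) hw y * y = 1 ∧ Valued.v (y - 1) ≤ WithZero.exp (-((j : ℤ) + 2 * e))}
      {x | galAdicCompletionMap (L := L) (IsCMField.complexConj L) hw x = -x ∧ Valued.v x ≤ WithZero.exp (-(j : ℤ))} := by
  have h := LocalFields.bijOn_invCayley_normOne_level_exp (σ := galAdicCompletionMap (L := L) (IsCMField.complexConj L) hw)
    (valued_two_eq_exp_of_ramified L v w hw he he2) hj
  have hcast : ((j : ℤ) + ((2 * e : ℕ) : ℤ)) = (j : ℤ) + 2 * e := by push_cast; ring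
  rwa [hcast] at h

include he in
/-- (C3) image form: `c '' (skew ball of level j) = torus level j + 2e`. [cite: Serre1979, Ch. V §3] -/
theorem image_cayley_skew_level_ramified {e : ℕ} (he2 : Valued.v (2 : v.adicCompletion ↥(maximalRealSubfield L)) = WithZero.exp (-(e : ℤ)))
    {j : ℕ} (hj : 1 ≤ j) :
    (fun x : w.1.adicCompletion L => (1 + x) / (1 - x)) ''
        {x | galAdicCompletionMap (L := L) (IsCMField.complexConj L) hw x = -x ∧ Valued.v x ≤ WithZero.exp (-(j : ℤ))} =
      {y | galAdicCompletionMap (L := L) (IsCMField.complexConj L) hw y * y = 1 ∧ Valued.v (y - 1) ≤ WithZero.exp (-((j : ℤ) + 2 * e))} :=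
  (bijOn_cayley_skew_level_ramified L v w hw he he2 hj).image_eq

include he in
/-- **(C3) in SKEW-LINE COORDINATES**: the skew ball of level `j` is `{ι_w q · (τ − σ_w τ) : |q|_v² · |σ_w τ − τ|_w ≤ exp(−j)}` — membership of `ι_w q · (τ − σ_w τ)` read on `q`
(★ `valued_toPlace_eq_sq_of_ramified`). [cite: Serre1979, Ch. IV §2] -/
theorem valued_toPlace_mul_sub_le_iff_of_ramified (τ : w.1.adicCompletion L) (q : v.adicCompletion ↥(maximalRealSubfield L)) (r : ℤᵐ⁰) :
    Valued.v (toPlace v w q * (τ - galAdicCompletionMap (L := L) (IsCMField.complexConj L) hw τ)) ≤ r ↔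
      Valued.v q ^ 2 * Valued.v (galAdicCompletionMap (L := L) (IsCMField.complexConj L) hw τ - τ) ≤ r := by
  rw [map_mul, valued_toPlace_eq_sq_of_ramified L v w hw he, Valuation.map_sub_swap]

end Literature.NumberTheory.Automorphic.UnitaryGroup

end
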